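import Summits.BirchSwinnertonDyer.Rank1Residual.Additive.InvariantClassCountAlgebra
import HarnessLib

/-!
# Counting `γ`-invariant classes modulo `p^m` along a layer filtration, II: the finset count, the
# `p`-group step and the main theorem (cell `b2b-bsdres`, CLASS-CLOSURE lane, class O10 — x1b GEN 39,
# class lead; file 80 of the series)

HONEST FRAMING (cell `b2b-bsdres`, run/shared/lean/b2b/bsd-rank1-residual/, verbatim in every
file): the goal of the cell is to DELETE the COMBINATION-SHAPED residual classes of the
Birch–Swinnerton-Dyer formula for ALL analytic-rank `≤ 1` elliptic curves over `ℚ` — "full BSD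
formula for every rank `≤ 1` curve in class `C`" assembled STRICTLY from published theorems — so
that the rank-`≤ 1` remainder becomes exactly the CONSTRUCTION-SHAPED classes, which are TYPED
(missing-input `Prop`s), NOT attempted. This is not "finishing BSD". CLASS-CLOSURE lane: prove
what is provable now; shrink each hard class to its core with data; no claim beyond stated classes;
research routes on CONSTRUCTION-SHAPED X12 / O10; census / instrument output = EVIDENCE / conjecture
items, NEVER a Literature fact; `RESIDUAL-MAP.md` marks change only by signed lines. THIS FILE:
PURE ALGEBRA, TOOL THEOREMS ONLY — no definition, no named Literature fact, no `sorry`, axioms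
standard; nothing is booked; no label / mark / count / sub-cell moves; nothing about any curve.

## What (continuation of file 79 `InvariantClassCountAlgebra`; all `[folklore]`)

§8 `exists_finset_step`, `exists_finset_tower` (a layer carrying a coinvariant class of order
exactly `p` multiplies the number of classes modulo `f(F)` by `p`; finsets only, no finiteness of
the ambient groups assumed); §9 `pow_min_le_card_torsionBy`, `exists_finset_torsion_classes` (the
subgroup of `A⧸f(N)` generated by the classes is a finite abelian `p`-group when `p^n N ⊆ f(N)`);
§10 `exists_finset_invariant_classes`; §11 **`exists_finset_invariant_mod_pow`** (main): for
`γ ∈ End_ℤ(A)`, layers `W_0 ≤ W_1 ≤ ⋯` with `γ^{p^k} = 1` on `W_k`, `γ` generating the layer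
quotients below `n`, no `p`-torsion in `W_n`, `N ≤ W_n` `γ`-stable with `N^γ = 0`, and witness
layers `S`: `p^{min(m,#S)}` points `x ∈ N` with `γx − x ∈ p^m N`, pairwise incongruent modulo
`p^m N` — the algebra of the B3 corank bound `#C⁻_η[p^m] ≥ p^m` (application: file 81).

References: [Kobayashi2003] Invent. Math. 152 (2003), Thm. 6.2, Prop. 8.12; [GreenbergLNM1716] §3.
-/

noncomputable section

open scoped Classical

namespace Summit.BirchSwinnertonDyer.Rank1Residual.Additive.InvariantCount

variable {A : Type*} [AddCommGroup A] (γ : Module.End ℤ A)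

/-! ### §8 Many classes modulo `f(F)` along a filtration -/

section Finset

variable (f : A →+ A)

/-- **Layer step WITH a witness** (`u ∈ F` of order exactly `p` modulo `f(F) + F'`, coinvariants
injective along `F' ≤ F`): the translates `y + a·u`, `a < p`, of `Y ⊆ F'` (distinct modulo `f(F')`)
are `p·#Y` elements of `F` distinct modulo `f(F)`. [folklore] -/
theorem exists_finset_step {F' F : AddSubgroup A} (hF'F : F' ≤ F) {p : ℕ} (hp : p.Prime)
    (hinj : ∀ x ∈ F, f x ∈ F' → x ∈ F')
    {u : A} (hu : u ∈ F) (hunot : u ∉ F.map f ⊔ F') (hpu : p • u ∈ F.map f ⊔ F')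
    (Y : Finset A) (hYF' : ∀ y ∈ Y, y ∈ F')
    (hYdist : ∀ y ∈ Y, ∀ y' ∈ Y, y - y' ∈ F'.map f → y = y') :
    ∃ Z : Finset A, Z.card = p * Y.card ∧ (∀ z ∈ Z, z ∈ F) ∧
      (∀ z ∈ Z, ∀ z' ∈ Z, z - z' ∈ F.map f → z = z') := by
  have hF'M : F' ≤ F.map f ⊔ F' := le_sup_right
  -- `t • u ∈ M` forces `p ∣ t`
  have hdvd : ∀ t : ℤ, t • u ∈ F.map f ⊔ F' → (p : ℤ) ∣ t := by
    intro t ht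
    by_contra hnd
    have hcop : IsCoprime t (p : ℤ) := by
      rw [Int.isCoprime_iff_gcd_eq_one]
      have := Int.gcd_dvd_right t p
      rcases (Nat.dvd_prime hp).mp (by exact_mod_cast Int.gcd_dvd_right t p : Int.gcd t p ∣ p) with h | h
      · exact h
      · exfalso
        apply hnd
        have h1 : ((Int.gcd t p : ℕ) : ℤ) ∣ t := Int.gcd_dvd_left t p
        rwa [h] at h1
    obtain ⟨α, β, hαβ⟩ := hcop
    apply hunot
    have : u = α • (t • u) + β • (p • u) := by
      rw [smul_smul, ← natCast_zsmul u p, smul_smul, ← add_smul, hαβ, one_smul]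
    rw [this]
    exact AddSubgroup.add_mem _ (AddSubgroup.zsmul_mem _ ht α) (AddSubgroup.zsmul_mem _ hpu β)
  -- the key separation property
  have hsep : ∀ y ∈ Y, ∀ y' ∈ Y, ∀ a < p, ∀ a' < p,
      (y + a • u) - (y' + a' • u) ∈ F.map f → y = y' ∧ a = a' := by
    intro y hy y' hy' a ha a' ha' hmem
    have hrew : (y + a • u) - (y' + a' • u) = (y - y') + ((a : ℤ) - a') • u := by
      rw [sub_smul, natCast_zsmul, natCast_zsmul]; abel
    rw [hrew] at hmem
    have ht : ((a : ℤ) - a') • u ∈ F.map f ⊔ F' := by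
      have h1 : (y - y') + ((a : ℤ) - a') • u ∈ F.map f ⊔ F' := le_sup_left (a := F.map f) hmem
      have h2 : y - y' ∈ F.map f ⊔ F' := hF'M (F'.sub_mem (hYF' y hy) (hYF' y' hy'))
      simpa using AddSubgroup.sub_mem _ h1 h2
    have hpdvd := hdvd _ ht
    have haa' : a = a' := by
      have : ((a : ℤ) - a').natAbs < p := by omega
      have h0 : (a : ℤ) - a' = 0 :=
        Int.eq_zero_of_dvd_of_natAbs_lt_natAbs hpdvd (by simpa using this)
      omega
    subst haa'
    refine ⟨hYdist y hy y' hy' ?_, rfl⟩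
    have hyy : y - y' ∈ F.map f := by simpa using hmem
    obtain ⟨x, hx, hfx⟩ := AddSubgroup.mem_map.mp hyy
    have hxF' : x ∈ F' := hinj x hx (hfx ▸ F'.sub_mem (hYF' y hy) (hYF' y' hy'))
    exact AddSubgroup.mem_map.mpr ⟨x, hxF', hfx⟩
  let g : A × ℕ → A := fun q => q.1 + q.2 • u
  have hginj : Set.InjOn g ↑(Y ×ˢ Finset.range p) := by
    rintro ⟨y, a⟩ hq ⟨y', a'⟩ hq' hqq
    simp only [Finset.coe_product, Finset.coe_range, Set.mem_prod, Finset.mem_coe, Set.mem_Iio] at hq hq'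
    have h := hsep y hq.1 y' hq'.1 a hq.2 a' hq'.2 (by
      rw [show (y + a • u) - (y' + a' • u) = 0 from sub_eq_zero.mpr hqq]; exact zero_mem _)
    exact Prod.ext h.1 h.2
  refine ⟨(Y ×ˢ Finset.range p).image g, ?_, ?_, ?_⟩
  · rw [Finset.card_image_of_injOn hginj, Finset.card_product, Finset.card_range, mul_comm]
  · intro z hz
    obtain ⟨⟨y, a⟩, hq, rfl⟩ := Finset.mem_image.mp hz
    rw [Finset.mem_product, Finset.mem_range] at hq
    exact F.add_mem (hF'F (hYF' y hq.1)) (F.nsmul_mem hu a)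
  · intro z hz z' hz' hzz'
    obtain ⟨⟨y, a⟩, hq, rfl⟩ := Finset.mem_image.mp hz
    obtain ⟨⟨y', a'⟩, hq', rfl⟩ := Finset.mem_image.mp hz'
    rw [Finset.mem_product, Finset.mem_range] at hq hq'
    have h := hsep y hq.1 y' hq'.1 a hq.2 a' hq'.2 hzz'
    change y + a • u = y' + a' • u
    rw [h.1, h.2]

/-- **Along a filtration** `F 0 ≤ F 1 ≤ ⋯` (coinvariants injective at every step; at each layer
`k ∈ S`, `0 ∉ S`, an element of order exactly `p` modulo `f(F k) + F (k−1)`): `F n` contains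
`p^{#{k ∈ S | k ≤ n}}` elements pairwise distinct modulo `f(F n)`. [folklore] -/
theorem exists_finset_tower (F : ℕ → AddSubgroup A) (hmono : ∀ k, F k ≤ F (k + 1)) {p : ℕ}
    (hp : p.Prime) (hinj : ∀ k, ∀ x ∈ F (k + 1), f x ∈ F k → x ∈ F k)
    (S : Finset ℕ) (hS0 : 0 ∉ S)
    (hwit : ∀ k ∈ S, ∃ u ∈ F k, u ∉ (F k).map f ⊔ F (k - 1) ∧ p • u ∈ (F k).map f ⊔ F (k - 1)) :
    ∀ n : ℕ, ∃ Y : Finset A, Y.card = p ^ (S.filter (· ≤ n)).card ∧ (∀ y ∈ Y, y ∈ F n) ∧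
      (∀ y ∈ Y, ∀ y' ∈ Y, y - y' ∈ (F n).map f → y = y')
  | 0 => by
    refine ⟨{0}, ?_, fun y hy => ?_, fun y hy y' hy' _ => ?_⟩
    · rw [Finset.card_singleton]
      have : S.filter (· ≤ 0) = ∅ := by
        rw [Finset.filter_eq_empty_iff]
        intro k hk hk0
        exact hS0 (by rwa [Nat.le_zero.mp hk0] at hk)
      rw [this, Finset.card_empty, pow_zero]
    · rw [Finset.mem_singleton] at hy; rw [hy]; exact zero_mem _
    · rw [Finset.mem_singleton] at hy hy'; rw [hy, hy']
  | n + 1 => by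
    obtain ⟨Y, hYcard, hYF, hYdist⟩ := exists_finset_tower F hmono hp hinj S hS0 hwit n
    rw [card_filter_le_succ]
    by_cases hmem : n + 1 ∈ S
    · obtain ⟨u, hu, hunot, hpu⟩ := hwit (n + 1) hmem
      rw [Nat.add_sub_cancel] at hunot hpu
      obtain ⟨Z, hZcard, hZF, hZdist⟩ :=
        exists_finset_step f (hmono n) hp (hinj n) hu hunot hpu Y hYF hYdist
      refine ⟨Z, ?_, hZF, hZdist⟩
      rw [hZcard, hYcard, if_pos hmem, pow_succ, mul_comm]
    · refine ⟨Y, ?_, fun y hy => hmono n (hYF y hy), finset_step_noWitness f (hinj n) Y hYF hYdist⟩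
      rw [hYcard, if_neg hmem, add_zero]

end Finset

/-! ### §9 Counting in a finite abelian `p`-group, and the quotient assembly -/

/-- A finite abelian group whose elements have `p`-power order and with `≥ p^c` elements has
`≥ p^{min(m,c)}` elements killed by `p^m`. [folklore] -/
theorem pow_min_le_card_torsionBy {H : Type*} [AddCommGroup H] [Finite H] {p : ℕ} (hp : p.Prime)
    (hH : ∀ h : H, ∃ j : ℕ, addOrderOf h = p ^ j) (m c : ℕ) (hc : p ^ c ≤ Nat.card H) :
    p ^ min m c ≤ Nat.card {h : H // p ^ m • h = 0} := by
  by_cases hall : ∀ h : H, p ^ m • h = 0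
  · rw [Nat.card_congr (Equiv.subtypeUnivEquiv hall)]
    exact le_trans (Nat.pow_le_pow_right hp.pos (min_le_right m c)) hc
  · push Not at hall
    obtain ⟨h, hh⟩ := hall
    obtain ⟨j, hj⟩ := hH h
    have hjm : m < j := by
      by_contra hle
      push Not at hle
      apply hh
      exact addOrderOf_dvd_iff_nsmul_eq_zero.mp (hj ▸ pow_dvd_pow p hle)
    set h' : H := p ^ (j - m) • h with hh'
    have hkill : p ^ m • h' = 0 := by
      rw [hh', smul_smul, ← pow_add, show m + (j - m) = j by omega, ← hj]
      exact addOrderOf_nsmul_eq_zero h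
    have hord : addOrderOf h' = p ^ m := by
      obtain ⟨i, hi, hi'⟩ := (Nat.dvd_prime_pow hp).mp (addOrderOf_dvd_iff_nsmul_eq_zero.mpr hkill)
      rw [hi']
      by_contra hne
      have him : i < m := lt_of_le_of_ne hi (fun h => hne (by rw [h]))
      -- then `p^(m-1) • h' = 0`, i.e. `p^(j-1) • h = 0`, contradicting `addOrderOf h = p^j`
      have h1 : p ^ (m - 1) • h' = 0 := by
        apply addOrderOf_dvd_iff_nsmul_eq_zero.mp
        rw [hi']
        exact pow_dvd_pow p (by omega)
      rw [hh', smul_smul, ← pow_add, show m - 1 + (j - m) = j - 1 by omega] at h1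
      have h2 : p ^ j ∣ p ^ (j - 1) := by
        rw [← hj]; exact addOrderOf_dvd_iff_nsmul_eq_zero.mpr h1
      have h3 := Nat.le_of_dvd (pow_pos hp.pos _) h2
      have h4 : p ^ (j - 1) < p ^ j := Nat.pow_lt_pow_right hp.one_lt (by omega)
      omega
    have hsub : ∀ x ∈ AddSubgroup.zmultiples h', p ^ m • x = 0 := by
      intro x hx
      obtain ⟨k, rfl⟩ := AddSubgroup.mem_zmultiples_iff.mp hx
      rw [smul_comm, hkill, smul_zero]
    calc p ^ min m c ≤ p ^ m := Nat.pow_le_pow_right hp.pos (min_le_left m c)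
      _ = Nat.card (AddSubgroup.zmultiples h') := by rw [Nat.card_zmultiples, hord]
      _ ≤ Nat.card {h : H // p ^ m • h = 0} :=
        Nat.card_le_card_of_injective (fun x => ⟨x.1, hsub x.1 x.2⟩)
          (by intro a b hab; simp only [Subtype.mk.injEq] at hab; exact Subtype.ext hab)

/-- **From `p^c` classes to `p^{min(m,c)}` classes killed by `p^m`** (`p^n N ⊆ M = f(N)`; the
subgroup of `A⧸M` generated by the classes is a finite abelian `p`-group of order `≥ p^c`). [folklore] -/
theorem exists_finset_torsion_classes (f : A →+ A) {N : AddSubgroup A} {p n : ℕ} (hp : p.Prime)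
    (htor : ∀ y ∈ N, p ^ n • y ∈ N.map f)
    (Y : Finset A) (hYN : ∀ y ∈ Y, y ∈ N)
    (hYdist : ∀ y ∈ Y, ∀ y' ∈ Y, y - y' ∈ N.map f → y = y') {c : ℕ} (hYcard : Y.card = p ^ c)
    (m : ℕ) :
    ∃ Z : Finset A, Z.card = p ^ min m c ∧ (∀ z ∈ Z, z ∈ N) ∧
      (∀ z ∈ Z, ∀ z' ∈ Z, z - z' ∈ N.map f → z = z') ∧ (∀ z ∈ Z, p ^ m • z ∈ N.map f) := by
  set M := N.map f with hM
  set π : A →+ A ⧸ M := QuotientAddGroup.mk' M with hπ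
  set Hs : AddSubgroup (A ⧸ M) := AddSubgroup.closure ((Y.image π : Finset (A ⧸ M)) : Set (A ⧸ M))
    with hHs
  have hHsN : Hs ≤ N.map π := by
    rw [hHs, AddSubgroup.closure_le, Finset.coe_image]
    rintro _ ⟨y, hy, rfl⟩
    exact AddSubgroup.mem_map_of_mem π (hYN y hy)
  have hkill : ∀ q ∈ N.map π, p ^ n • q = 0 := by
    rintro _ ⟨y, hy, rfl⟩
    rw [← map_nsmul, hπ, QuotientAddGroup.mk'_apply, QuotientAddGroup.eq_zero_iff]
    exact htor y hy
  have hkill' : ∀ h : Hs, p ^ n • h = 0 := fun h => Subtype.ext (hkill h.1 (hHsN h.2))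
  have htors : AddMonoid.IsTorsion Hs := fun h =>
    isOfFinAddOrder_iff_nsmul_eq_zero.mpr ⟨p ^ n, pow_pos hp.pos n, hkill' h⟩
  haveI : Finite Hs := AddCommGroup.finite_of_fg_torsion Hs htors
  have hpgrp : ∀ h : Hs, ∃ j : ℕ, addOrderOf h = p ^ j := fun h => by
    obtain ⟨j, -, hj⟩ := (Nat.dvd_prime_pow hp).mp (addOrderOf_dvd_iff_nsmul_eq_zero.mpr (hkill' h))
    exact ⟨j, hj⟩
  -- `#Hs ≥ p^c`
  have hcard : p ^ c ≤ Nat.card Hs := by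
    let e : Y → Hs := fun y => ⟨π (y : A), AddSubgroup.subset_closure (by
      rw [Finset.coe_image]; exact ⟨(y : A), y.2, rfl⟩)⟩
    have he : Function.Injective e := by
      rintro ⟨y, hy⟩ ⟨y', hy'⟩ h
      simp only [e, Subtype.mk.injEq] at h
      have hyy : y - y' ∈ M := by
        rw [← QuotientAddGroup.eq_iff_sub_mem, ← QuotientAddGroup.mk'_apply, ← QuotientAddGroup.mk'_apply,
          ← hπ]
        exact h
      exact Subtype.ext (hYdist y hy y' hy' hyy)
    have h1 := Nat.card_le_card_of_injective e he
    rwa [Nat.card_eq_fintype_card, Fintype.card_coe, hYcard] at h1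
  have hcount := pow_min_le_card_torsionBy hp hpgrp m c hcard
  -- extract a finset of `p^{min(m,c)}` classes killed by `p^m`
  haveI : Fintype {h : Hs // p ^ m • h = 0} := Fintype.ofFinite _
  obtain ⟨T, -, hTcard⟩ := Finset.exists_subset_card_eq
    (s := (Finset.univ : Finset {h : Hs // p ^ m • h = 0})) (n := p ^ min m c)
    (by rwa [Finset.card_univ, ← Nat.card_eq_fintype_card])
  -- lift each class to `N`
  have hlift : ∀ t : {h : Hs // p ^ m • h = 0}, ∃ y ∈ N, π y = (t.1 : A ⧸ M) := fun t =>
    AddSubgroup.mem_map.mp (hHsN t.1.2)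
  choose lift hliftN hliftπ using hlift
  have hlift_inj : Function.Injective lift := by
    intro t t' h
    have h1 : (t.1 : A ⧸ M) = (t'.1 : A ⧸ M) := by rw [← hliftπ t, ← hliftπ t', h]
    exact Subtype.ext (Subtype.ext h1)
  refine ⟨T.image lift, ?_, ?_, ?_, ?_⟩
  · rw [Finset.card_image_of_injective _ hlift_inj, hTcard]
  · intro z hz
    obtain ⟨t, -, rfl⟩ := Finset.mem_image.mp hz
    exact hliftN t
  · intro z hz z' hz' hzz'
    obtain ⟨t, -, rfl⟩ := Finset.mem_image.mp hz
    obtain ⟨t', -, rfl⟩ := Finset.mem_image.mp hz'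
    have h1 : π (lift t) = π (lift t') := by
      rw [hπ, QuotientAddGroup.mk'_apply, QuotientAddGroup.mk'_apply, QuotientAddGroup.eq_iff_sub_mem]
      exact hzz'
    rw [hliftπ, hliftπ] at h1
    rw [show t = t' from Subtype.ext (Subtype.ext h1)]
  · intro z hz
    obtain ⟨t, -, rfl⟩ := Finset.mem_image.mp hz
    have h1 : π (p ^ m • lift t) = 0 := by
      rw [map_nsmul, hliftπ]
      have := t.2
      have h2 : ((p ^ m • t.1 : Hs) : A ⧸ M) = 0 := by rw [this]; rfl
      exact h2
    rwa [hπ, QuotientAddGroup.mk'_apply, QuotientAddGroup.eq_zero_iff] at h1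

/-! ### §10 From classes killed by `p^m` modulo `f(N)` to `γ`-invariant classes modulo `p^m N` -/

/-- **Conversion** (`N` `f`-stable, no `p`-torsion): `p^m z = f(x_z)` for `Z ⊆ N` distinct modulo
`f(N)` ⟹ the `x_z ∈ N` are distinct modulo `p^m N` with `f(x_z) ∈ p^m N`. [folklore] -/
theorem exists_finset_invariant_classes (f : A →+ A) {N : AddSubgroup A} (hfN : ∀ x ∈ N, f x ∈ N)
    {p m : ℕ} (htorsN : ∀ x ∈ N, p • x = 0 → x = 0)
    (Z : Finset A) (hZN : ∀ z ∈ Z, z ∈ N)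
    (hZdist : ∀ z ∈ Z, ∀ z' ∈ Z, z - z' ∈ N.map f → z = z')
    (hZtor : ∀ z ∈ Z, p ^ m • z ∈ N.map f) :
    ∃ X : Finset A, X.card = Z.card ∧ (∀ x ∈ X, x ∈ N ∧ ∃ y ∈ N, f x = p ^ m • y) ∧
      (∀ x ∈ X, ∀ x' ∈ X, (∃ w ∈ N, x - x' = p ^ m • w) → x = x') := by
  have hnoTor : ∀ x ∈ N, p ^ m • x = 0 → x = 0 := noPowTorsion htorsN m
  -- choose `x_z ∈ N` with `f x_z = p^m z`
  have hch : ∀ z : Z, ∃ x ∈ N, f x = p ^ m • (z : A) := fun z =>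
    AddSubgroup.mem_map.mp (hZtor z z.2)
  choose xz hxzN hxz using hch
  have hsep : ∀ z z' : Z, (∃ w ∈ N, xz z - xz z' = p ^ m • w) → z = z' := by
    rintro z z' ⟨w, hw, hzz⟩
    have h1 : p ^ m • ((z : A) - z' - f w) = 0 := by
      rw [smul_sub, smul_sub, ← hxz z, ← hxz z', ← map_nsmul, ← hzz, map_sub, sub_self]
    have h2 : (z : A) - z' - f w = 0 :=
      hnoTor _ (N.sub_mem (N.sub_mem (hZN z z.2) (hZN z' z'.2)) (hfN w hw)) h1
    have h3 : (z : A) - z' ∈ N.map f := by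
      rw [sub_eq_zero] at h2
      rw [h2]
      exact AddSubgroup.mem_map_of_mem f hw
    exact Subtype.ext (hZdist z z.2 z' z'.2 h3)
  have hinj : Function.Injective xz := fun z z' h =>
    hsep z z' ⟨0, N.zero_mem, by rw [h, sub_self, smul_zero]⟩
  refine ⟨Finset.univ.image xz, ?_, ?_, ?_⟩
  · rw [Finset.card_image_of_injective _ hinj, Finset.card_univ, Fintype.card_coe]
  · intro x hx
    obtain ⟨z, -, rfl⟩ := Finset.mem_image.mp hx
    exact ⟨hxzN z, (z : A), hZN z z.2, hxz z⟩
  · intro x hx x' hx' hw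
    obtain ⟨z, -, rfl⟩ := Finset.mem_image.mp hx
    obtain ⟨z', -, rfl⟩ := Finset.mem_image.mp hx'
    rw [hsep z z' hw]

/-! ### §11 Main theorem of the file -/

/-- **Many `γ`-invariant classes modulo `p^m`** (statement in the module docstring): layers `W_k`
with `γ^{p^k} = 1` on `W_k`, `γ` generating the layer quotients below `n`, no `p`-torsion in `W_n`,
`N ≤ W_n` `γ`-stable with `N^γ = 0`, witness layers `S` ⟹ `p^{min(m,#S)}` points `x ∈ N` with
`γx − x ∈ p^m N`, pairwise incongruent modulo `p^m N` (files 79 §3/§5–§7 + §8–§10 here). [folklore] -/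
theorem exists_finset_invariant_mod_pow {p : ℕ} (hp : p.Prime)
    (W : ℕ → AddSubgroup A) (N : AddSubgroup A) (n : ℕ) (hNW : N ≤ W n)
    (hWγ : ∀ k, ∀ x ∈ W k, γ x ∈ W k) (hNγ : ∀ x ∈ N, γ x ∈ N)
    (hWmono : ∀ k, W k ≤ W (k + 1))
    (hfix : ∀ k, ∀ x ∈ W k, (γ ^ p ^ k) x = x)
    (hgen : ∀ k < n, ∀ x ∈ W (k + 1), (γ ^ p ^ k) x = x → x ∈ W k)
    (htors : ∀ x ∈ W n, p • x = 0 → x = 0)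
    (hinvN : ∀ z ∈ N, γ z = z → z = 0)
    (S : Finset ℕ) (hS0 : 0 ∉ S) (hSn : ∀ k ∈ S, k ≤ n)
    (hwit : ∀ k ∈ S, ∃ w ∈ N ⊓ W k, ¬ ∃ a ∈ N ⊓ W k, ∃ b ∈ N ⊓ W (k - 1), w = p • a + b)
    (m : ℕ) :
    ∃ X : Finset A, X.card = p ^ min m S.card ∧
      (∀ x ∈ X, x ∈ N ∧ ∃ y ∈ N, γ x - x = p ^ m • y) ∧
      (∀ x ∈ X, ∀ x' ∈ X, (∃ w ∈ N, x - x' = p ^ m • w) → x = x') := by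
  set f : A →+ A := ((γ - 1 : Module.End ℤ A) : A →+ A) with hfdef
  have hf : ∀ x, f x = γ x - x := fun x => by
    rw [hfdef, AddMonoidHom.coe_coe, LinearMap.sub_apply, Module.End.one_apply]
  set F : ℕ → AddSubgroup A := fun k => N ⊓ W k with hF
  have hWle : ∀ {k l : ℕ}, k ≤ l → W k ≤ W l := fun hkl => (monotone_nat_of_le_succ hWmono) hkl
  have hFγ : ∀ k, ∀ x ∈ F k, γ x ∈ F k := fun k x hx =>
    ⟨hNγ x hx.1, hWγ k x hx.2⟩
  have hFmono : ∀ k, F k ≤ F (k + 1) := fun k x hx => ⟨hx.1, hWmono k hx.2⟩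
  have hFn : F n = N := inf_of_le_left hNW
  have hFfix : ∀ k, ∀ x ∈ F k, (γ ^ p ^ k) x = x := fun k x hx => hfix k x hx.2
  have hFinv : ∀ k, ∀ z ∈ F k, γ z = z → z = 0 := fun k z hz h => hinvN z hz.1 h
  -- §3: injectivity of coinvariants along the layers
  have hinj : ∀ k, ∀ x ∈ F (k + 1), f x ∈ F k → x ∈ F k := by
    intro k x hx hfx
    refine ⟨hx.1, ?_⟩
    rcases Nat.lt_or_ge k n with hk | hk
    · exact mem_of_sub_one_apply_mem γ (hWγ k) (hfix (k + 1)) (hfix k) (hgen k hk)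
        (fun y hy h => htors y (hWle hk.le hy) h) hx.2 ((hf x) ▸ hfx.2)
    · exact hWle hk (hNW hx.1)
  -- §5–§7: each witness layer gives a class of order exactly `p`
  have hwit' : ∀ k ∈ S, ∃ u ∈ F k, u ∉ (F k).map f ⊔ F (k - 1) ∧ p • u ∈ (F k).map f ⊔ F (k - 1) := by
    intro k hk
    obtain ⟨w, hw, hwnot⟩ := hwit k hk
    have hk0 : k ≠ 0 := fun h => hS0 (h ▸ hk)
    obtain ⟨j, rfl⟩ : ∃ j, k = j + 1 := Nat.exists_eq_succ_of_ne_zero hk0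
    obtain ⟨u, hu, hunot⟩ := exists_not_mem_sup γ hp j (hFγ (j + 1)) (hFγ (j + 1 - 1))
      (hFfix (j + 1)) hw hwnot
    obtain ⟨x, hx, hpx⟩ := exists_sub_one_apply_eq_pow_smul γ (hFγ (j + 1)) (hFfix (j + 1))
      (hFinv (j + 1)) hu
    have hpow : p ^ (j + 1) • u ∈ (F (j + 1)).map f ⊔ F (j + 1 - 1) := by
      refine AddSubgroup.mem_sup_left (AddSubgroup.mem_map.mpr ⟨x, hx, ?_⟩)
      rw [hf, ← hpx, LinearMap.sub_apply, Module.End.one_apply]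
    exact exists_not_mem_and_smul_mem hu hunot hpow
  -- §8: `p^{#S}` classes modulo `f(N)`
  obtain ⟨Y, hYcard, hYF, hYdist⟩ := exists_finset_tower f F hFmono hp hinj S hS0 hwit' n
  have hSfilter : S.filter (· ≤ n) = S := Finset.filter_true_of_mem hSn
  rw [hSfilter] at hYcard
  rw [hFn] at hYF hYdist
  · -- §9 and §10
    have htor : ∀ y ∈ N, p ^ n • y ∈ N.map f := by
      intro y hy
      obtain ⟨x, hx, hpx⟩ := exists_sub_one_apply_eq_pow_smul γ hNγ (fun x hx => hfix n x (hNW hx))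
        hinvN hy
      exact AddSubgroup.mem_map.mpr ⟨x, hx, by rw [hf, ← hpx, LinearMap.sub_apply, Module.End.one_apply]⟩
    obtain ⟨Z, hZcard, hZN, hZdist, hZtor⟩ :=
      exists_finset_torsion_classes f hp htor Y hYF hYdist hYcard m
    obtain ⟨X, hXcard, hXN, hXdist⟩ := exists_finset_invariant_classes f
      (fun x hx => (hf x) ▸ N.sub_mem (hNγ x hx) hx) (fun x hx h => htors x (hNW hx) h) Z hZN hZdist hZtor
    refine ⟨X, by rw [hXcard, hZcard], fun x hx => ?_, hXdist⟩
    obtain ⟨hxN, y, hy, hxy⟩ := hXN x hx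
    exact ⟨hxN, y, hy, (hf x) ▸ hxy⟩

end Summit.BirchSwinnertonDyer.Rank1Residual.Additive.InvariantCount

end
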